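import Summits.CriticalPhenomena.Ising3DConformalLimit.Theses.ReflectionTwin
import Summits.CriticalPhenomena.Ising3DConformalLimit.Theorems.HyperoctahedralRPExistsScaleCovariantLimitDecimationTwoCouplingGKS
import Literature.Probability.LatticeModels.PairIsingAffineTransport
import HarnessLib

/-!
# Crux `TwinThreshold` (stmt-CriticalPhenomena-16906), line `seam_renewal` — stub `stub_noOrderAtOnset_of_bubbleIntegrable` ((C′) transport principle: an integrable sub-threshold thick-plane bubble forces no plane order AT the onset)

Registered stub of the checked skeleton `Cruxes/TwinThreshold/Lines/seam_renewal.lean`, proved EXACTLY as registered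
(`--supports stmt-CriticalPhenomena-16906`). The model-free analysis (fluctuation formula, Lebowitz/Newman bound,
FTC transport, endpoint argument) is the Literature leaf
`Literature/Probability/LatticeModels/PairIsingAffineTransport.lean` (`PairIsing.transport_affine`,
`endpoint_disorder_of_transport`); this file supplies the (111)-twin geometry and assembles the stub:

* `near_cases`, `thick_of_near`, `sum_ite_le_nine` — a twin-adjacent pair `{a, b}` has `b ∈ {a ± eᵢ, eᵢ - a}`, a `J`-bond
  (one end on the plane `h = 0`) has both ends in the thick plane `h ∈ {-1,0,1}`, and a site meets at most nine candidates;
* `row_le`, `col_le` — the `J`-bonds `c₁ = cpl 1 - cpl 0` have row and column sums `≤ (9β_c/2)·𝟙_thick`;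
* `noOrderAtOnset_model` — (C2) ⟹ (C) for the twin coupling written over an abstract adjacency `P` with these two
  properties (affine decomposition `cpl J = c₀ + J c₁`, `PairIsing.transport_affine`, `endpoint_disorder_of_transport`);
* `stub_noOrderAtOnset_of_bubbleIntegrable` — the registered signature, by instantiating `P` with the crux adjacency.
-/

noncomputable section

namespace Summit.CriticalPhenomena.Ising3DConformalLimit.Cruxes.TwinThreshold.SeamRenewal

open scoped BigOperators Classical
open Filter Topology Finset
open Literature.Probability.LatticeModels

namespace OnsetTransport

open MeasureTheory
open Summit.CriticalPhenomena.Ising3DConformalLimit.Cruxes.ExistsScaleCovariantLimit.DecimationHomotopyRate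

/-! ## Geometry of the (111) twin bonds on `Site 3` -/

/-- A nearest-neighbour pair of `ℤ³` differs by a unit vector. [folklore] -/
theorem exists_eq_add_or_sub_of_sum_abs {a b : Site 3} (h : ∑ i, |a i - b i| = 1) :
    ∃ i : Fin 3, b = a + Pi.single i 1 ∨ b = a - Pi.single i 1 := by
  simp only [Fin.sum_univ_three] at h
  have key : (b 0 = a 0 + 1 ∧ b 1 = a 1 ∧ b 2 = a 2) ∨ (b 0 = a 0 - 1 ∧ b 1 = a 1 ∧ b 2 = a 2) ∨
      (b 0 = a 0 ∧ b 1 = a 1 + 1 ∧ b 2 = a 2) ∨ (b 0 = a 0 ∧ b 1 = a 1 - 1 ∧ b 2 = a 2) ∨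
      (b 0 = a 0 ∧ b 1 = a 1 ∧ b 2 = a 2 + 1) ∨ (b 0 = a 0 ∧ b 1 = a 1 ∧ b 2 = a 2 - 1) := by
    rcases abs_cases (a 0 - b 0) with ⟨k0, s0⟩ | ⟨k0, s0⟩ <;>
    rcases abs_cases (a 1 - b 1) with ⟨k1, s1⟩ | ⟨k1, s1⟩ <;>
    rcases abs_cases (a 2 - b 2) with ⟨k2, s2⟩ | ⟨k2, s2⟩ <;>
    · rw [k0, k1, k2] at h; omega
  rcases key with ⟨h0, h1, h2⟩ | ⟨h0, h1, h2⟩ | ⟨h0, h1, h2⟩ | ⟨h0, h1, h2⟩ | ⟨h0, h1, h2⟩ | ⟨h0, h1, h2⟩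
  · exact ⟨0, Or.inl (funext fun j => by fin_cases j <;> simp [h0, h1, h2])⟩
  · exact ⟨0, Or.inr (funext fun j => by fin_cases j <;> simp [h0, h1, h2])⟩
  · exact ⟨1, Or.inl (funext fun j => by fin_cases j <;> simp [h0, h1, h2])⟩
  · exact ⟨1, Or.inr (funext fun j => by fin_cases j <;> simp [h0, h1, h2])⟩
  · exact ⟨2, Or.inl (funext fun j => by fin_cases j <;> simp [h0, h1, h2])⟩
  · exact ⟨2, Or.inr (funext fun j => by fin_cases j <;> simp [h0, h1, h2])⟩

/-- Twin-adjacency candidates: `b ∈ {a + eᵢ, a - eᵢ, eᵢ - a}`. [folklore] -/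
theorem near_cases {a b : Site 3} (h : (∑ i, |a i - b i| = 1) ∨ ∃ i : Fin 3, a + b = Pi.single i 1) :
    ∃ i : Fin 3, b = a + Pi.single i 1 ∨ b = a - Pi.single i 1 ∨ b = Pi.single i 1 - a := by
  rcases h with hs | ⟨i, hi⟩
  · obtain ⟨i, hi | hi⟩ := exists_eq_add_or_sub_of_sum_abs hs
    · exact ⟨i, Or.inl hi⟩
    · exact ⟨i, Or.inr (Or.inl hi)⟩
  · exact ⟨i, Or.inr (Or.inr (by rw [← hi]; abel))⟩

/-- The candidate relation is symmetric. [folklore] -/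
theorem near_symm {a b : Site 3} (h : (∑ i, |a i - b i| = 1) ∨ ∃ i : Fin 3, a + b = Pi.single i 1) :
    (∑ i, |b i - a i| = 1) ∨ ∃ i : Fin 3, b + a = Pi.single i 1 := by
  have hs : ∑ i, |b i - a i| = ∑ i, |a i - b i| := Finset.sum_congr rfl fun i _ => abs_sub_comm _ _
  rw [hs, add_comm b a]
  exact h

/-- A `J`-bond (n.n. bond or reflected bond between layers `0`, `1`, with one end on the plane) has both ends in the thick
plane `h ∈ {-1, 0, 1}`. [folklore] -/
theorem thick_of_near {a b : Site 3}
    (h : (∑ i, |a i - b i| = 1) ∨ ((a 0 + a 1 + a 2 = 0 ∧ b 0 + b 1 + b 2 = 1) ∨ (a 0 + a 1 + a 2 = 1 ∧ b 0 + b 1 + b 2 = 0)))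
    (h0 : a 0 + a 1 + a 2 = 0 ∨ b 0 + b 1 + b 2 = 0) :
    (a 0 + a 1 + a 2 = -1 ∨ a 0 + a 1 + a 2 = 0 ∨ a 0 + a 1 + a 2 = 1) ∧
      (b 0 + b 1 + b 2 = -1 ∨ b 0 + b 1 + b 2 = 0 ∨ b 0 + b 1 + b 2 = 1) := by
  rcases h with hs | hl
  · have habs : |(a 0 + a 1 + a 2) - (b 0 + b 1 + b 2)| ≤ 1 := by
      have h3 : (a 0 + a 1 + a 2) - (b 0 + b 1 + b 2) = ∑ i : Fin 3, (a i - b i) := by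
        simp only [Fin.sum_univ_three]; ring
      rw [h3, ← hs]
      exact Finset.abs_sum_le_sum_abs _ _
    rw [abs_le] at habs
    omega
  · omega

/-- At most one box site has a given underlying site. [folklore] -/
theorem sum_ite_val_eq_le_one (L : ℕ) (v : Site 3) :
    (∑ b : ↥(box 3 L), if b.1 = v then (1 : ℝ) else 0) ≤ 1 := by
  rw [Finset.sum_boole]
  have h : #({b ∈ (univ : Finset ↥(box 3 L)) | b.1 = v}) ≤ 1 := by
    refine Finset.card_le_one.2 fun p hp q hq => ?_
    simp only [Finset.mem_filter, Finset.mem_univ, true_and] at hp hq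
    exact Subtype.ext (hp.trans hq.symm)
  exact_mod_cast h

/-- **Seam degree count**: a predicate on box sites supported on the nine candidates of `a` has indicator sum `≤ 9`. [folklore] -/
theorem sum_ite_le_nine (L : ℕ) (a : Site 3) (Q : ↥(box 3 L) → Prop) [DecidablePred Q]
    (hQ : ∀ b, Q b → ∃ i : Fin 3, b.1 = a + Pi.single i 1 ∨ b.1 = a - Pi.single i 1 ∨ b.1 = Pi.single i 1 - a) :
    (∑ b : ↥(box 3 L), if Q b then (1 : ℝ) else 0) ≤ 9 := by
  have hpt : ∀ b : ↥(box 3 L), (if Q b then (1 : ℝ) else 0) ≤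
      ∑ i : Fin 3, ((if b.1 = a + Pi.single i 1 then (1 : ℝ) else 0) +
        (if b.1 = a - Pi.single i 1 then (1 : ℝ) else 0) + (if b.1 = Pi.single i 1 - a then (1 : ℝ) else 0)) := by
    intro b
    have hnn : ∀ i ∈ (univ : Finset (Fin 3)), (0 : ℝ) ≤ (if b.1 = a + Pi.single i 1 then (1 : ℝ) else 0) +
        (if b.1 = a - Pi.single i 1 then (1 : ℝ) else 0) + (if b.1 = Pi.single i 1 - a then (1 : ℝ) else 0) :=
      fun i _ => by positivity
    split_ifs with hab
    · obtain ⟨i, hi⟩ := hQ b hab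
      refine le_trans ?_ (Finset.single_le_sum hnn (Finset.mem_univ i))
      have h1 : (0 : ℝ) ≤ if b.1 = a + Pi.single i 1 then (1 : ℝ) else 0 := by positivity
      have h2 : (0 : ℝ) ≤ if b.1 = a - Pi.single i 1 then (1 : ℝ) else 0 := by positivity
      have h3 : (0 : ℝ) ≤ if b.1 = Pi.single i 1 - a then (1 : ℝ) else 0 := by positivity
      rcases hi with hi | hi | hi
      · have : (if b.1 = a + Pi.single i 1 then (1 : ℝ) else 0) = 1 := if_pos hi
        linarith
      · have : (if b.1 = a - Pi.single i 1 then (1 : ℝ) else 0) = 1 := if_pos hi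
        linarith
      · have : (if b.1 = Pi.single i 1 - a then (1 : ℝ) else 0) = 1 := if_pos hi
        linarith
    · exact Finset.sum_nonneg hnn
  refine (Finset.sum_le_sum fun b _ => hpt b).trans ?_
  rw [Finset.sum_comm]
  have h3 : ∀ i : Fin 3, (∑ b : ↥(box 3 L), ((if b.1 = a + Pi.single i 1 then (1 : ℝ) else 0) +
      (if b.1 = a - Pi.single i 1 then (1 : ℝ) else 0) + (if b.1 = Pi.single i 1 - a then (1 : ℝ) else 0))) ≤ 3 := by
    intro i
    rw [Finset.sum_add_distrib, Finset.sum_add_distrib]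
    have := sum_ite_val_eq_le_one L (a + Pi.single i 1)
    have := sum_ite_val_eq_le_one L (a - Pi.single i 1)
    have := sum_ite_val_eq_le_one L (Pi.single i 1 - a)
    linarith
  calc (∑ i : Fin 3, ∑ b : ↥(box 3 L), ((if b.1 = a + Pi.single i 1 then (1 : ℝ) else 0) +
      (if b.1 = a - Pi.single i 1 then (1 : ℝ) else 0) + (if b.1 = Pi.single i 1 - a then (1 : ℝ) else 0)))
      ≤ ∑ _i : Fin 3, (3 : ℝ) := Finset.sum_le_sum fun i _ => h3 i
    _ = 9 := by norm_num

/-- `|∏ᵢ σ_{zᵢ}| ≤ 1` for the junk-padded box monomial. [folklore] -/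
theorem abs_prod_dite_le_one (L : ℕ) {k : ℕ} (z : Fin k → Site 3) (s : SpinConfig ↥(box 3 L)) :
    |(∏ i, if h : z i ∈ box 3 L then spinAt (⟨z i, h⟩ : ↥(box 3 L)) s else 0 : ℝ)| ≤ 1 := by
  rw [Finset.abs_prod]
  refine Finset.prod_le_one (fun _ _ => abs_nonneg _) fun i _ => ?_
  split_ifs
  · rw [abs_spinAt]
  · simp

/-- The padded two-point monomial of `![0, c]`: the box average is `⟨σ₀σ_c⟩` if `c` is in the box. [folklore] -/
theorem gibbsAvg_prod_two_of_mem {L : ℕ} {c : Site 3} (hc : c ∈ box 3 L) (cc : ↥(box 3 L) → ↥(box 3 L) → ℝ) :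
    PairIsing.gibbsAvg cc (fun s => ∏ i, if h : (![0, c] : Fin 2 → Site 3) i ∈ box 3 L then spinAt (⟨(![0, c] : Fin 2 → Site 3) i, h⟩ : ↥(box 3 L)) s else 0) =
      PairIsing.gibbsAvg cc (fun s => spinAt (⟨0, zero_mem_box 3 L⟩ : ↥(box 3 L)) s * spinAt (⟨c, hc⟩ : ↥(box 3 L)) s) := by
  congr 1
  funext s
  simp only [Fin.prod_univ_two, Matrix.cons_val_zero, Matrix.cons_val_one]
  rw [dif_pos (zero_mem_box 3 L), dif_pos hc]

/-- The padded two-point monomial of `![0, c]`: the box average vanishes if `c` is off the box. [folklore] -/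
theorem gibbsAvg_prod_two_of_not_mem {L : ℕ} {c : Site 3} (hc : c ∉ box 3 L) (cc : ↥(box 3 L) → ↥(box 3 L) → ℝ) :
    PairIsing.gibbsAvg cc (fun s => ∏ i, if h : (![0, c] : Fin 2 → Site 3) i ∈ box 3 L then spinAt (⟨(![0, c] : Fin 2 → Site 3) i, h⟩ : ↥(box 3 L)) s else 0) = 0 := by
  have h : (fun s => ∏ i, if h : (![0, c] : Fin 2 → Site 3) i ∈ box 3 L then spinAt (⟨(![0, c] : Fin 2 → Site 3) i, h⟩ : ↥(box 3 L)) s else 0) = fun (_ : SpinConfig ↥(box 3 L)) => (0 : ℝ) := by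
    funext s
    simp only [Fin.prod_univ_two, Matrix.cons_val_zero, Matrix.cons_val_one]
    rw [dif_neg hc, mul_zero]
  rw [h, PairIsing.gibbsAvg_const]

/-! ## The twin coupling over an abstract adjacency `P`: row and column sums of the `J`-bonds -/

section Model

variable (P : Site 3 → Site 3 → Prop) [∀ a b, Decidable (P a b)]

/-- **Row sums of the `J`-bonds**: `∑_b c₁(a,b) ≤ (9β_c/2)·𝟙_thick(a)`. [folklore] -/
theorem row_le (hPnear : ∀ a b, P a b → (∑ i, |a i - b i| = 1) ∨ ∃ i : Fin 3, a + b = Pi.single i 1)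
    (hPthick : ∀ a b, P a b → (a 0 + a 1 + a 2 = 0 ∨ b 0 + b 1 + b 2 = 0) →
      (a 0 + a 1 + a 2 = -1 ∨ a 0 + a 1 + a 2 = 0 ∨ a 0 + a 1 + a 2 = 1) ∧
        (b 0 + b 1 + b 2 = -1 ∨ b 0 + b 1 + b 2 = 0 ∨ b 0 + b 1 + b 2 = 1))
    (L : ℕ) (a : ↥(box 3 L)) :
    (∑ b : ↥(box 3 L), if P a.1 b.1 then (criticalBeta 3 / 2) *
        (if a.1 0 + a.1 1 + a.1 2 = 0 ∨ b.1 0 + b.1 1 + b.1 2 = 0 then (1 : ℝ) else 0) else 0) ≤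
      (9 * (criticalBeta 3 / 2)) * (if (a.1 0 + a.1 1 + a.1 2 = -1 ∨ a.1 0 + a.1 1 + a.1 2 = 0 ∨ a.1 0 + a.1 1 + a.1 2 = 1) then (1 : ℝ) else 0) := by
  have hβ : 0 ≤ criticalBeta 3 / 2 := div_nonneg (criticalBeta_nonneg 3) zero_le_two
  by_cases hT : (a.1 0 + a.1 1 + a.1 2 = -1 ∨ a.1 0 + a.1 1 + a.1 2 = 0 ∨ a.1 0 + a.1 1 + a.1 2 = 1)
  · rw [if_pos hT, mul_one]
    have hle : ∀ b : ↥(box 3 L), (if P a.1 b.1 then (criticalBeta 3 / 2) *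
        (if a.1 0 + a.1 1 + a.1 2 = 0 ∨ b.1 0 + b.1 1 + b.1 2 = 0 then (1 : ℝ) else 0) else 0) ≤
        (criticalBeta 3 / 2) * (if P a.1 b.1 then (1 : ℝ) else 0) := by
      intro b
      split_ifs <;> nlinarith
    refine (Finset.sum_le_sum fun b _ => hle b).trans ?_
    rw [← Finset.mul_sum, mul_comm (9 : ℝ)]
    exact mul_le_mul_of_nonneg_left
      (sum_ite_le_nine L a.1 (fun b => P a.1 b.1) fun b hb => near_cases (hPnear _ _ hb)) hβ
  · rw [if_neg hT, mul_zero]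
    refine le_of_eq (Finset.sum_eq_zero fun b _ => ?_)
    split_ifs with h1 h2
    · exact absurd (hPthick _ _ h1 h2).1 hT
    · ring
    · rfl

/-- **Column sums of the `J`-bonds**: `∑_a c₁(a,b) ≤ (9β_c/2)·𝟙_thick(b)`. [folklore] -/
theorem col_le (hPnear : ∀ a b, P a b → (∑ i, |a i - b i| = 1) ∨ ∃ i : Fin 3, a + b = Pi.single i 1)
    (hPthick : ∀ a b, P a b → (a 0 + a 1 + a 2 = 0 ∨ b 0 + b 1 + b 2 = 0) →
      (a 0 + a 1 + a 2 = -1 ∨ a 0 + a 1 + a 2 = 0 ∨ a 0 + a 1 + a 2 = 1) ∧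
        (b 0 + b 1 + b 2 = -1 ∨ b 0 + b 1 + b 2 = 0 ∨ b 0 + b 1 + b 2 = 1))
    (L : ℕ) (b : ↥(box 3 L)) :
    (∑ a : ↥(box 3 L), if P a.1 b.1 then (criticalBeta 3 / 2) *
        (if a.1 0 + a.1 1 + a.1 2 = 0 ∨ b.1 0 + b.1 1 + b.1 2 = 0 then (1 : ℝ) else 0) else 0) ≤
      (9 * (criticalBeta 3 / 2)) * (if (b.1 0 + b.1 1 + b.1 2 = -1 ∨ b.1 0 + b.1 1 + b.1 2 = 0 ∨ b.1 0 + b.1 1 + b.1 2 = 1) then (1 : ℝ) else 0) := by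
  have hβ : 0 ≤ criticalBeta 3 / 2 := div_nonneg (criticalBeta_nonneg 3) zero_le_two
  by_cases hT : (b.1 0 + b.1 1 + b.1 2 = -1 ∨ b.1 0 + b.1 1 + b.1 2 = 0 ∨ b.1 0 + b.1 1 + b.1 2 = 1)
  · rw [if_pos hT, mul_one]
    have hle : ∀ a : ↥(box 3 L), (if P a.1 b.1 then (criticalBeta 3 / 2) *
        (if a.1 0 + a.1 1 + a.1 2 = 0 ∨ b.1 0 + b.1 1 + b.1 2 = 0 then (1 : ℝ) else 0) else 0) ≤
        (criticalBeta 3 / 2) * (if P a.1 b.1 then (1 : ℝ) else 0) := by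
      intro a
      split_ifs <;> nlinarith
    refine (Finset.sum_le_sum fun a _ => hle a).trans ?_
    rw [← Finset.mul_sum, mul_comm (9 : ℝ)]
    exact mul_le_mul_of_nonneg_left
      (sum_ite_le_nine L b.1 (fun a => P a.1 b.1) fun a ha => near_cases (near_symm (hPnear _ _ ha))) hβ
  · rw [if_neg hT, mul_zero]
    refine le_of_eq (Finset.sum_eq_zero fun a _ => ?_)
    split_ifs with h1 h2
    · exact absurd (hPthick _ _ h1 h2).2 hT
    · ring
    · rfl

/-- **(C2) ⟹ (C) for the twin coupling over an abstract adjacency `P`** whose bonds are candidates (`hPnear`) and whose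
`J`-bonds live in the thick plane (`hPthick`): write `cpl J = c₀ + J·c₁` in each box, bound the row/column sums of `c₁`
(`row_le`, `col_le`), transport the box two-point function `⟨σ₀σ_c⟩` below the candidate onset with the majorant `|Bf|`
(`PairIsing.transport_affine`; (C2) is invoked at `t < J` with the disordered `J'' = (t+J)/2`), and conclude with the endpoint
argument `endpoint_disorder_of_transport` (box averages are `≤ 1` and continuous in `J`). [folklore] -/
theorem noOrderAtOnset_model
    (hPnear : ∀ a b, P a b → (∑ i, |a i - b i| = 1) ∨ ∃ i : Fin 3, a + b = Pi.single i 1)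
    (hPthick : ∀ a b, P a b → (a 0 + a 1 + a 2 = 0 ∨ b 0 + b 1 + b 2 = 0) →
      (a 0 + a 1 + a 2 = -1 ∨ a 0 + a 1 + a 2 = 0 ∨ a 0 + a 1 + a 2 = 1) ∧
        (b 0 + b 1 + b 2 = -1 ∨ b 0 + b 1 + b 2 = 0 ∨ b 0 + b 1 + b 2 = 1)) :
    (∃ Bf : ℝ → ℝ, (∀ J₁ : ℝ, IntervalIntegrable Bf MeasureTheory.volume 0 J₁) ∧ ∀ J J'' : ℝ, 0 ≤ J → J < J'' →
      ¬ (∃ m : ℝ, 0 < m ∧ ∀ c : Site 3, c 0 + c 1 + c 2 = 0 → m ≤ ⨆ L : ℕ, PairIsing.gibbsAvg (fun a b : ↥(box 3 L) => if P a.1 b.1 then (criticalBeta 3 / 2) * (if a.1 0 + a.1 1 + a.1 2 = 0 ∨ b.1 0 + b.1 1 + b.1 2 = 0 then J'' else 1) else 0) (fun s => ∏ i, if h : (![0, c] : Fin 2 → Site 3) i ∈ box 3 L then spinAt (⟨(![0, c] : Fin 2 → Site 3) i, h⟩ : ↥(box 3 L)) s else 0)) →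
      ∀ (L : ℕ) (x : ↥(box 3 L)), x.1 0 + x.1 1 + x.1 2 = 0 → (∑ u : ↥(box 3 L),
        if (u.1 0 + u.1 1 + u.1 2 = -1 ∨ u.1 0 + u.1 1 + u.1 2 = 0 ∨ u.1 0 + u.1 1 + u.1 2 = 1) then
          PairIsing.gibbsAvg (fun a b : ↥(box 3 L) => if P a.1 b.1 then (criticalBeta 3 / 2) * (if a.1 0 + a.1 1 + a.1 2 = 0 ∨ b.1 0 + b.1 1 + b.1 2 = 0 then J else 1) else 0) (fun s => spinAt x s * spinAt u s) ^ 2 else 0) ≤ Bf J) →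
    ∀ J : ℝ, 0 < J → (∀ J' : ℝ, 0 ≤ J' → J' < J →
      ¬ (∃ m : ℝ, 0 < m ∧ ∀ c : Site 3, c 0 + c 1 + c 2 = 0 → m ≤ ⨆ L : ℕ, PairIsing.gibbsAvg (fun a b : ↥(box 3 L) => if P a.1 b.1 then (criticalBeta 3 / 2) * (if a.1 0 + a.1 1 + a.1 2 = 0 ∨ b.1 0 + b.1 1 + b.1 2 = 0 then J' else 1) else 0) (fun s => ∏ i, if h : (![0, c] : Fin 2 → Site 3) i ∈ box 3 L then spinAt (⟨(![0, c] : Fin 2 → Site 3) i, h⟩ : ↥(box 3 L)) s else 0))) →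
    ¬ (∃ m : ℝ, 0 < m ∧ ∀ c : Site 3, c 0 + c 1 + c 2 = 0 → m ≤ ⨆ L : ℕ, PairIsing.gibbsAvg (fun a b : ↥(box 3 L) => if P a.1 b.1 then (criticalBeta 3 / 2) * (if a.1 0 + a.1 1 + a.1 2 = 0 ∨ b.1 0 + b.1 1 + b.1 2 = 0 then J else 1) else 0) (fun s => ∏ i, if h : (![0, c] : Fin 2 → Site 3) i ∈ box 3 L then spinAt (⟨(![0, c] : Fin 2 → Site 3) i, h⟩ : ↥(box 3 L)) s else 0)) := by
  rintro ⟨Bf, hint, hbub⟩ Jon hJon hdis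
  have hβ : 0 ≤ criticalBeta 3 / 2 := div_nonneg (criticalBeta_nonneg 3) zero_le_two
  -- the affine decomposition `cpl J = c₀ + J c₁` in each box
  set c₀ : (L : ℕ) → ↥(box 3 L) → ↥(box 3 L) → ℝ := fun L a b =>
    if P a.1 b.1 then (criticalBeta 3 / 2) * (if a.1 0 + a.1 1 + a.1 2 = 0 ∨ b.1 0 + b.1 1 + b.1 2 = 0 then 0 else 1) else 0
    with hc₀
  set c₁ : (L : ℕ) → ↥(box 3 L) → ↥(box 3 L) → ℝ := fun L a b =>
    if P a.1 b.1 then (criticalBeta 3 / 2) * (if a.1 0 + a.1 1 + a.1 2 = 0 ∨ b.1 0 + b.1 1 + b.1 2 = 0 then 1 else 0) else 0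
    with hc₁
  have hc₀nn : ∀ L a b, 0 ≤ c₀ L a b := fun L a b => by
    simp only [hc₀]
    split_ifs <;> positivity
  have hc₁nn : ∀ L a b, 0 ≤ c₁ L a b := fun L a b => by
    simp only [hc₁]
    split_ifs <;> positivity
  have hcpl : ∀ (L : ℕ) (t : ℝ) (a b : ↥(box 3 L)), (fun a b : ↥(box 3 L) => if P a.1 b.1 then (criticalBeta 3 / 2) * (if a.1 0 + a.1 1 + a.1 2 = 0 ∨ b.1 0 + b.1 1 + b.1 2 = 0 then t else 1) else 0) a b = c₀ L a b + t * c₁ L a b := by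
    intro L t a b
    simp only [hc₀, hc₁]
    split_ifs <;> ring
  -- the majorant `B = |Bf|` and the bubble bound on the whole left ray `[0, Jon)`
  have hBi : ∀ a b : ℝ, IntervalIntegrable (fun t => |Bf t|) volume a b := fun a b =>
    ((hint a).symm.trans (hint b)).abs
  have hbubB : ∀ t : ℝ, 0 ≤ t → t < Jon → ∀ (L : ℕ) (x : ↥(box 3 L)), x.1 0 + x.1 1 + x.1 2 = 0 →
      (∑ u : ↥(box 3 L), (if (u.1 0 + u.1 1 + u.1 2 = -1 ∨ u.1 0 + u.1 1 + u.1 2 = 0 ∨ u.1 0 + u.1 1 + u.1 2 = 1) then (1 : ℝ) else 0) *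
        PairIsing.gibbsAvg (fun a b : ↥(box 3 L) => if P a.1 b.1 then (criticalBeta 3 / 2) * (if a.1 0 + a.1 1 + a.1 2 = 0 ∨ b.1 0 + b.1 1 + b.1 2 = 0 then t else 1) else 0) (fun s => spinAt x s * spinAt u s) ^ 2) ≤ |Bf t| := by
    intro t ht0 htJ L x hx
    have hmid := hdis ((t + Jon) / 2) (by linarith) (by linarith)
    have h := (hbub t ((t + Jon) / 2) ht0 (by linarith) hmid L x hx).trans (le_abs_self _)
    simpa only [ite_mul, one_mul, zero_mul] using h
  refine endpoint_disorder_of_transport (fun c : Site 3 => c 0 + c 1 + c 2 = 0)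
    (fun (c : Site 3) (L : ℕ) (J : ℝ) => PairIsing.gibbsAvg (fun a b : ↥(box 3 L) => if P a.1 b.1 then (criticalBeta 3 / 2) * (if a.1 0 + a.1 1 + a.1 2 = 0 ∨ b.1 0 + b.1 1 + b.1 2 = 0 then J else 1) else 0) (fun s => ∏ i, if h : (![0, c] : Fin 2 → Site 3) i ∈ box 3 L then spinAt (⟨(![0, c] : Fin 2 → Site 3) i, h⟩ : ↥(box 3 L)) s else 0))
    (K := 2 * (9 * (criticalBeta 3 / 2))) (by positivity) (fun t => |Bf t|) (fun t => abs_nonneg _) hBi hJon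
    (fun c L J => (le_abs_self _).trans (TwoCouplingGKS.abs_gibbsAvg_le_one _ (abs_prod_dite_le_one L _)))
    (fun c L => PairIsing.continuous_gibbsAvg_of_affine _ (c₀ L) (c₁ L) (hcpl L) _) ?_ hdis
  -- the transport below the onset, box by box
  intro c hc L J₁ J₂ hJ₁ h12 h2J
  by_cases hcm : c ∈ box 3 L
  · rw [gibbsAvg_prod_two_of_mem hcm, gibbsAvg_prod_two_of_mem hcm]
    have h0 : (⟨0, zero_mem_box 3 L⟩ : ↥(box 3 L)).1 0 + (⟨0, zero_mem_box 3 L⟩ : ↥(box 3 L)).1 1 +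
        (⟨0, zero_mem_box 3 L⟩ : ↥(box 3 L)).1 2 = 0 := by simp
    exact PairIsing.transport_affine _ (c₀ L) (c₁ L) (hcpl L) (hc₀nn L) (hc₁nn L) _ (by positivity)
      (row_le P hPnear hPthick L) (col_le P hPnear hPthick L) _ _ hJ₁ h12 (hBi J₁ J₂)
      (fun t ht => hbubB t (hJ₁.trans ht.1) (lt_of_le_of_lt ht.2 h2J) L _ h0)
      (fun t ht => hbubB t (hJ₁.trans ht.1) (lt_of_le_of_lt ht.2 h2J) L _ hc)
  · rw [gibbsAvg_prod_two_of_not_mem hcm, gibbsAvg_prod_two_of_not_mem hcm, sub_self]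
    exact mul_nonneg (by positivity) (intervalIntegral.integral_nonneg_of_forall h12 fun t => abs_nonneg _)

end Model

end OnsetTransport

/-- **(C′) Transport principle: an integrable sub-threshold bubble forces continuity AT the onset** — registered stub
`stub_noOrderAtOnset_of_bubbleIntegrable` of line `seam_renewal`, `(C2) → (C)`. In the free box
`d/dJ ⟨σ₀σ_c⟩_{TW(J),Λ} = Cov(σ₀σ_c; H₁)` with `H₁` the `J`-bond energy (`PairIsing.hasDerivAt_gibbsAvg_affine`);
Lebowitz/Newman `u₄ ≤ 0` (`PairIsing.cov_pair_pair_le`, from `PairIsing.avg_spinMonomial_le_pairingSum` and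
`pairingSum_two`) and `ab ≤ (a²+b²)/2` with the seam degree count bound it by `2R·|Bf(J)|` below a disordered coupling
(`PairIsing.cov_energy_le`, `R = 9β_c/2`); FTC on `[J₁,J₂] ⊂ [0,J)` (`PairIsing.transport_affine`) and `sup_L`
give `twinLat J₂ ≤ twinLat J₁ + 2R ∫_{J₁}^{J₂} |Bf|`; left-continuity of each box average in `J` extends it to `J₂ = J`;
if `LRO J` held with constant `m`, a `J₁ < J` with `2R∫_{J₁}^{J}|Bf| ≤ m/2` (continuity of the primitive) would carry
`LRO J₁`, contradicting the disordered ray (`endpoint_disorder_of_transport`). Obtained from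
`OnsetTransport.noOrderAtOnset_model` at the crux adjacency (beta/delta only).
[cite: Lebowitz1974, Theorem, eq. (2.5b) (u₄ ≤ 0)] [cite: FriedliVelenik2017, §3.8.1 (finite-volume Gibbs averages)] -/
theorem stub_noOrderAtOnset_of_bubbleIntegrable : open Literature.Probability.LatticeModels in ((fun (hZ : Site 3 → ℤ) => (fun (twinLat : ℝ → (k : ℕ) → (Fin k → Site 3) → ℝ) => (fun (boxPair : ℝ → (L : ℕ) → ↥(box 3 L) → ↥(box 3 L) → ℝ) => (fun (LRO : ℝ → Prop) => (∃ Bf : ℝ → ℝ, (∀ J₁ : ℝ, IntervalIntegrable Bf MeasureTheory.volume 0 J₁) ∧ ∀ J J'' : ℝ, 0 ≤ J → J < J'' → ¬ LRO J'' → ∀ (L : ℕ) (x : ↥(box 3 L)), hZ x.1 = 0 → (∑ u : ↥(box 3 L), if (hZ u.1 = -1 ∨ hZ u.1 = 0 ∨ hZ u.1 = 1) then boxPair J L x u ^ 2 else 0) ≤ Bf J) → ∀ J : ℝ, 0 < J → (∀ J' : ℝ, 0 ≤ J' → J' < J → ¬ LRO J') → ¬ LRO J) (fun J : ℝ => ∃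 m : ℝ, 0 < m ∧ ∀ c : Site 3, hZ c = 0 → m ≤ twinLat J 2 ![0, c])) (fun (J : ℝ) (L : ℕ) (x u : ↥(box 3 L)) => PairIsing.gibbsAvg (fun a b : ↥(box 3 L) => if (((∑ i, |a.1 i - b.1 i| = 1) ∧ ¬ ((a.1 0 + a.1 1 + a.1 2 = 0 ∧ b.1 0 + b.1 1 + b.1 2 = 1) ∨ (a.1 0 + a.1 1 + a.1 2 = 1 ∧ b.1 0 + b.1 1 + b.1 2 = 0))) ∨ (((a.1 0 + a.1 1 + a.1 2 = 0 ∧ b.1 0 + b.1 1 + b.1 2 = 1) ∨ (a.1 0 + a.1 1 + a.1 2 = 1 ∧ b.1 0 + b.1 1 + b.1 2 = 0)) ∧ ∃ i : Fin 3, a.1 + b.1 = Pi.single i 1)) then (criticalBeta 3 / 2) * (if a.1 0 + a.1 1 + a.1 2 = 0 ∨ b.1 0 + b.1 1 + b.1 2 = 0 then J else 1) else 0) (fun s => spinAt x s * spinAt u s))) (fun (J : ℝ) (k : ℕ) (z : Fin k → Site 3) => ⨆ L : ℕ, PairIsing.gibbsAvg (fun a b : ↥(box 3 L) => if (((∑ i,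 |a.1 i - b.1 i| = 1) ∧ ¬ ((a.1 0 + a.1 1 + a.1 2 = 0 ∧ b.1 0 + b.1 1 + b.1 2 = 1) ∨ (a.1 0 + a.1 1 + a.1 2 = 1 ∧ b.1 0 + b.1 1 + b.1 2 = 0))) ∨ (((a.1 0 + a.1 1 + a.1 2 = 0 ∧ b.1 0 + b.1 1 + b.1 2 = 1) ∨ (a.1 0 + a.1 1 + a.1 2 = 1 ∧ b.1 0 + b.1 1 + b.1 2 = 0)) ∧ ∃ i : Fin 3, a.1 + b.1 = Pi.single i 1)) then (criticalBeta 3 / 2) * (if a.1 0 + a.1 1 + a.1 2 = 0 ∨ b.1 0 + b.1 1 + b.1 2 = 0 then J else 1) else 0) (fun s => ∏ i, if h : z i ∈ box 3 L then spinAt (⟨z i, h⟩ : ↥(box 3 L)) s else 0))) (fun z : Site 3 => z 0 + z 1 + z 2)) :=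
  OnsetTransport.noOrderAtOnset_model
    (fun a b : Site 3 => ((∑ i, |a i - b i| = 1) ∧ ¬ ((a 0 + a 1 + a 2 = 0 ∧ b 0 + b 1 + b 2 = 1) ∨ (a 0 + a 1 + a 2 = 1 ∧ b 0 + b 1 + b 2 = 0))) ∨ (((a 0 + a 1 + a 2 = 0 ∧ b 0 + b 1 + b 2 = 1) ∨ (a 0 + a 1 + a 2 = 1 ∧ b 0 + b 1 + b 2 = 0)) ∧ ∃ i : Fin 3, a + b = Pi.single i 1))
    (fun _ _ h => h.elim (fun h1 => Or.inl h1.1) (fun h2 => Or.inr h2.2))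
    (fun _ _ h => OnsetTransport.thick_of_near (h.elim (fun h1 => Or.inl h1.1) (fun h2 => Or.inr h2.1)))

end Summit.CriticalPhenomena.Ising3DConformalLimit.Cruxes.TwinThreshold.SeamRenewal

end
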